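/-
Copyright: derived here (Resolution Observatory cell `pub-rosobs`, carver gen 58). AI-written Lean; AI review is weaker than expert
review.  The degree-`p` case of engine 1's pin argument (THEOREM-LT-eng1-g38 §9 PROPOSITION B (3), §11 THEOREM B″ first step) for the
cell's POLYNOMIAL weighted-centre model `W(f)`.  Instrument — NOT a resolution theorem and NOT a statement about the invariant of
[AbramovichTemkinWlodarczyk2024].
-/
import Literature.AlgebraicGeometry.Resolution.WeightedCentreLinearRigidity
import Mathlib.RingTheory.MvPolynomial.Homogeneous
import Mathlib.LinearAlgebra.LinearIndependent.Lemmas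
import HarnessLib

/-!
# The Frobenius pin: a degree-`p` form killed by `∂_i` carries `X_i` only as `X_i^p` (PROPOSITION B (3), THEOREM B″ step 1)

Uniform value line: INSTRUMENT — kernel-checked commutative algebra for engine 1's boundary statements (THEOREM-LT-eng1-g38 §9
PROPOSITION B (3) and §11 THEOREM B″, the `σ¹`-coefficient step) in the cell's polynomial weighted-centre model `W(f)`; NOT a resolution
theorem, NOT a statement about the Abramovich–Temkin–Włodarczyk invariant, NOT summit progress, and NOT a proof of PROPOSITION B or of
THEOREM B″ themselves (their inputs FC / IT / (R0) / LT stay the engine's); AI-written Lean, AI review is weaker than expert review.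

## Dictionary (engine prose → this file)

LEMMA K (`WeightedCentrePinFamilyKappa`, `WeightedCentreLinearRigidity`) treats pin forms of degree `d_h < p`: a kernel direction of
`∂` becomes an ABSENT variable.  At the sharp rate `ρ₁ = 1/(p(p+1))` the empty heavy part `h = 1` has pin degree EXACTLY `p`
(`BoundaryArith.pin_degree_top`), and the conclusion weakens to "present only as a `p`-th power":

* §1 (any commutative ring) `eq_zero_of_sum_X_mul_eq_zero` — `Σ_{j ∈ T} X_j · H_j = 0` with every `H_j` free of the `T`-variables forces
  `H_j = 0` (apply `∂_j`); **`eq_zero_of_sum_linearForm_mul_eq_zero`** — `Σ_i ℓ_i · G_i = 0` with `ℓ_i = Σ_{j ∈ T} c_{ij} X_j` linear forms in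
  the `T`-variables whose coefficient rows are linearly independent and `G_i` free of `T` forces `G_i = 0`.  This is THEOREM B″'s first
  step "`Σ_i ℓ_i(W) · ∂_{f_i} F(f) = 0`, `F` is `W`-free and the `ℓ_i` are independent, so `∂_{f_i} F = 0`" (`T` = the `W`-class,
  `G_i = ∂_{f_i} F`, `T`-free by `notMem_vars_pderiv`).
* §2 (field of characteristic `p`) **`eq_single_of_pderiv_eq_zero`** — if `P` is homogeneous of degree `p` and `∂_i P = 0`, every monomial
  of `P` containing `X_i` IS `X_i^p` (its `X_i`-exponent is a positive multiple of `p`, `dvd_of_pderiv_eq_zero`, and at most the degree `p`);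
  `coeff_single_ne_zero_of_mem_vars` — so if `X_i` occurs in `P` at all ("pinned"), the FROBENIUS MONOMIAL `c · X_i^p`, `c ≠ 0`, is present;
  `notMem_vars_sub_C_mul_X_pow` / **`notMem_vars_sub_sum_C_mul_X_pow`** — `P = c · X_i^p + P'` with `X_i ∉ P'`, and for a set `S` of such
  slots `P = Σ_{i ∈ S} c_i X_i^p + P₀` with no `S`-variable in `P₀`: THEOREM B″'s "`F = Σ_{i ≤ r} a_i f_i^p + F₀(f″)`", and
  `pderiv_eq_zero_and_normalForm` chains §1 and §2.
* §3 (PROPOSITION B (3) in the coordinates of LEMMA K) **`eq_single_of_lineSubst`** / `coeff_lineSubst_single_ne_zero` — for a pin form `P₁`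
  homogeneous of degree `p` and a kernel direction `r` (`Σ_k r_k ∂_k P₁ = 0`), after the class-linear change `A = lineSubst u₀ r`
  (`A e_{u₀} = r`; `WeightedCentreDirectionalDerivative`) the new coordinate `X_{u₀}` occurs in `P₁ ∘ A` only through `X_{u₀}^p`, and if the
  slot stays pinned there (`u₀ ∈ vars (P₁ ∘ A)`, the model's `(P)`) then `X_{u₀}^p` is a monomial of `P₁ ∘ A` — "a slot `f₀` of weight
  exactly `1/p` whose only pin is a Frobenius monomial `c · ε_{f₀}^p`".  The forms `P_h`, `h ≠ 1`, have degree `< p` and lose `X_{u₀}`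
  altogether: that is the tree's `LinearRigidity.notMem_vars_lineSubst_of_isHomogeneous'` and is not repeated.

NOT here: the weight arithmetic of PROPOSITION B (`WeightedCentreBoundaryArith`), the Hasse-derivative conditions on `F₀` and the
`σ^{kp}`-layers of THEOREM B″ (the directional Hasse calculus is `WeightedCentreHasseSubspace`), the count over `𝔽_p`.

References: [Hironaka1970AdditiveGroups] (additive forms; the derivative criterion in characteristic `p`: `∂_i F = 0` iff every
`X_i`-exponent is a multiple of `p`); [Giraud1975] §1 (forms of degree `p` and their `p`-th-power part); context
[AbramovichTemkinWlodarczyk2024] §5 (weights of weighted centres).  Statements ours, elementary.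
-/

open MvPolynomial

namespace Literature.AlgebraicGeometry.Resolution.WeightedBlowup

namespace FrobeniusPin

/-! ## §1 Linear forms with free coefficients (any commutative ring) -/

section LinearForms

variable {R : Type*} [CommRing R] {σ : Type*}

/-- A partial derivative involves no new variables: `l ∉ vars F ⇒ l ∉ vars (∂_i F)`. (derived here; folklore)
[cite: Hironaka1970AdditiveGroups, additive forms and differential operators] -/
theorem notMem_vars_pderiv {F : MvPolynomial σ R} {l : σ} (i : σ) (hl : l ∉ F.vars) : l ∉ (pderiv i F).vars := by
  classical
  intro hv
  rw [mem_vars_iff_mem_support] at hv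
  obtain ⟨γ, hγ, hlγ⟩ := hv
  rw [mem_support_iff, coeff_pderiv] at hγ
  refine hl ((mem_vars_iff_mem_support l).mpr ⟨γ + Finsupp.single i 1, mem_support_iff.2 (left_ne_zero_of_mul hγ), ?_⟩)
  rw [Finsupp.mem_support_iff] at hlγ ⊢
  rw [Finsupp.add_apply]
  omega

/-- **Free coefficients of distinct variables.**  If `Σ_{j ∈ T} X_j · H_j = 0` and no `H_j` involves a `T`-variable, then every
`H_j = 0` (apply `∂_j`: it kills the `H`'s and `∂_j X_l = δ_{jl}`). (derived here)
[cite: Hironaka1970AdditiveGroups, additive forms and differential operators] -/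
theorem eq_zero_of_sum_X_mul_eq_zero (T : Finset σ) (H : σ → MvPolynomial σ R)
    (hH : ∀ j ∈ T, ∀ l ∈ T, l ∉ (H j).vars) (h0 : ∑ j ∈ T, X j * H j = 0) : ∀ j ∈ T, H j = 0 := by
  classical
  intro j hj
  have h := congrArg (pderiv j) h0
  rw [map_sum, map_zero, Finset.sum_eq_single j] at h
  · simpa [Derivation.leibniz, smul_eq_mul, pderiv_X_self, pderiv_eq_zero_of_notMem_vars (hH j hj j hj)] using h
  · intro l hl hlj
    simp [Derivation.leibniz, smul_eq_mul, pderiv_X_of_ne hlj, pderiv_eq_zero_of_notMem_vars (hH l hl j hj)]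
  · intro h'
    exact absurd hj h'

/-- **THEOREM B″, first step (core form).**  Linear forms `ℓ_i = Σ_{j ∈ T} c_{ij} X_j` in the `T`-variables whose coefficient rows
admit no non-trivial relation `Σ_i a_i c_{ij} = 0 (j ∈ T)`, and `T`-free polynomials `G_i`: `Σ_i ℓ_i · G_i = 0 ⇒ G_i = 0` for all `i`
(regroup by `X_j`, free coefficients `Σ_i c_{ij} G_i = 0`, then coefficientwise). (derived here)
[cite: Hironaka1970AdditiveGroups, additive forms and differential operators] -/
theorem eq_zero_of_sum_linearForm_mul_eq_zero {ι : Type*} [Fintype ι] (T : Finset σ) (c : ι → σ → R)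
    (hc : ∀ a : ι → R, (∀ j ∈ T, ∑ i, a i * c i j = 0) → a = 0)
    (G : ι → MvPolynomial σ R) (hG : ∀ i, ∀ l ∈ T, l ∉ (G i).vars)
    (h0 : ∑ i, (∑ j ∈ T, C (c i j) * X j) * G i = 0) : ∀ i, G i = 0 := by
  classical
  have h1 : ∑ j ∈ T, X j * (∑ i, C (c i j) * G i) = 0 := by
    rw [← h0]
    simp_rw [Finset.mul_sum, Finset.sum_mul]
    rw [Finset.sum_comm]
    exact Finset.sum_congr rfl fun i _ => Finset.sum_congr rfl fun j _ => by ring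
  have hfree : ∀ j ∈ T, ∀ l ∈ T, l ∉ (∑ i, C (c i j) * G i).vars := by
    intro j _ l hl hmem
    obtain ⟨i, -, hi⟩ := Finset.mem_biUnion.mp (vars_sum_subset _ _ hmem)
    rcases Finset.mem_union.mp (vars_mul _ _ hi) with h | h
    · simp [vars_C] at h
    · exact hG i l hl h
  have hK := eq_zero_of_sum_X_mul_eq_zero T _ hfree h1
  intro i
  ext m
  have ha : (fun i => coeff m (G i)) = 0 := by
    refine hc _ fun j hj => ?_
    have := congrArg (coeff m) (hK j hj)
    rw [coeff_sum, coeff_zero] at this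
    simp only [coeff_C_mul] at this
    simpa [mul_comm] using this
  simpa using congrFun ha i

/-- The same with the hypothesis stated as LINEAR INDEPENDENCE of the coefficient rows `(c_{ij})_{j ∈ T}` (THEOREM B″: "`ℓ₁, …, ℓ_r`
linearly independent linear forms"). (derived here) [cite: Hironaka1970AdditiveGroups, additive forms and differential operators] -/
theorem eq_zero_of_sum_linearForm_mul_eq_zero' {ι : Type*} [Fintype ι] (T : Finset σ) (c : ι → σ → R)
    (hc : LinearIndependent R fun i => fun j : T => c i j)
    (G : ι → MvPolynomial σ R) (hG : ∀ i, ∀ l ∈ T, l ∉ (G i).vars)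
    (h0 : ∑ i, (∑ j ∈ T, C (c i j) * X j) * G i = 0) : ∀ i, G i = 0 := by
  refine eq_zero_of_sum_linearForm_mul_eq_zero T c (fun a ha => ?_) G hG h0
  funext i
  refine Fintype.linearIndependent_iff.mp hc a ?_ i
  funext j
  simpa [Finset.sum_apply, Pi.smul_apply, smul_eq_mul] using ha j j.2

end LinearForms

/-! ## §2 The Frobenius monomial of a degree-`p` form (field of characteristic `p`) -/

section CharP

variable {K : Type*} [Field K] {σ : Type*}

/-- **A degree-`p` form killed by `∂_i` contains `X_i` only as `X_i^p`.**  If `P` is homogeneous of degree `p = char K`, `∂_i P = 0`,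
and a monomial `d` of `P` involves `X_i`, then `d = X_i^p` (the exponent is a positive multiple of `p` and at most `p`, and then
nothing else fits). (derived here) [cite: Hironaka1970AdditiveGroups, additive forms and differential operators] -/
theorem eq_single_of_pderiv_eq_zero (p : ℕ) [CharP K p] {P : MvPolynomial σ K} (hP : P.IsHomogeneous p) {i : σ}
    (hD : pderiv i P = 0) {d : σ →₀ ℕ} (hd : d ∈ P.support) (hdi : d i ≠ 0) : d = Finsupp.single i p := by
  classical
  have hdeg : d.degree = p := by
    by_contra h
    exact (mem_support_iff.mp hd) (hP.coeff_eq_zero h)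
  have hle : d i ≤ p := hdeg ▸ Finsupp.le_degree i d
  have hge : p ≤ d i := Nat.le_of_dvd (Nat.pos_of_ne_zero hdi) (dvd_of_pderiv_eq_zero p hD hd)
  have hdi' : d i = p := le_antisymm hle hge
  have hsplit := Finsupp.single_add_erase i d
  have hsum : (Finsupp.single i (d i)).degree + (d.erase i).degree = p := by
    rw [← map_add, hsplit, hdeg]
  rw [Finsupp.degree_single, hdi'] at hsum
  have h0 : (d.erase i).degree = 0 := by omega
  rw [Finsupp.degree_eq_zero_iff] at h0
  rw [← hsplit, h0, add_zero, hdi']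

/-- Under the same hypotheses the characteristic is positive as soon as `X_i` occurs (bookkeeping used below). (derived here)
[cite: Hironaka1970AdditiveGroups, additive forms and differential operators] -/
theorem char_ne_zero_of_mem_vars (p : ℕ) [CharP K p] {P : MvPolynomial σ K} (hP : P.IsHomogeneous p) {i : σ}
    (hD : pderiv i P = 0) (hi : i ∈ P.vars) : p ≠ 0 := by
  classical
  obtain ⟨d, hd, hdi⟩ := (mem_vars_iff_mem_support i).mp hi
  have hdi' := Finsupp.mem_support_iff.mp hdi
  have h := eq_single_of_pderiv_eq_zero p hP hD hd hdi'
  rw [h, Finsupp.single_eq_same] at hdi'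
  exact hdi'

/-- **Pinned ⇒ the Frobenius monomial is present.**  If moreover `X_i` occurs in `P` at all, then the coefficient of `X_i^p` in `P`
is non-zero. (derived here) [cite: Hironaka1970AdditiveGroups, additive forms and differential operators] -/
theorem coeff_single_ne_zero_of_mem_vars (p : ℕ) [CharP K p] {P : MvPolynomial σ K} (hP : P.IsHomogeneous p) {i : σ}
    (hD : pderiv i P = 0) (hi : i ∈ P.vars) : coeff (Finsupp.single i p) P ≠ 0 := by
  classical
  obtain ⟨d, hd, hdi⟩ := (mem_vars_iff_mem_support i).mp hi
  have h := eq_single_of_pderiv_eq_zero p hP hD hd (Finsupp.mem_support_iff.mp hdi)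
  rw [← h]
  exact mem_support_iff.mp hd

/-- **Splitting off the Frobenius monomial.**  `P = c · X_i^p + P'` with `c = coeff_{X_i^p} P` and `X_i ∉ vars P'`. (derived here)
[cite: Hironaka1970AdditiveGroups, additive forms and differential operators] -/
theorem notMem_vars_sub_C_mul_X_pow (p : ℕ) [CharP K p] {P : MvPolynomial σ K} (hP : P.IsHomogeneous p) {i : σ}
    (hD : pderiv i P = 0) : i ∉ (P - C (coeff (Finsupp.single i p) P) * X i ^ p).vars := by
  classical
  intro hmem
  obtain ⟨d, hd, hdi⟩ := (mem_vars_iff_mem_support i).mp hmem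
  have hdi' : d i ≠ 0 := Finsupp.mem_support_iff.mp hdi
  have hc : coeff d (P - C (coeff (Finsupp.single i p) P) * X i ^ p) =
      coeff d P - (if Finsupp.single i p = d then coeff (Finsupp.single i p) P else 0) := by
    rw [coeff_sub, C_mul_X_pow_eq_monomial, coeff_monomial]
  have hne := mem_support_iff.mp hd
  rw [hc] at hne
  by_cases h : Finsupp.single i p = d
  · rw [if_pos h, ← h, sub_self] at hne
    exact hne rfl
  · rw [if_neg h, sub_zero] at hne
    exact h (eq_single_of_pderiv_eq_zero p hP hD (mem_support_iff.mpr hne) hdi').symm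

/-- **THEOREM B″'s normal form `F = Σ_{i ∈ S} a_i f_i^p + F₀(f″)`.**  If `∂_i P = 0` for every `i` in a set `S` of slots, then
`P₀ := P − Σ_{i ∈ S} coeff_{X_i^p}(P) · X_i^p` involves no variable of `S`. (derived here)
[cite: Hironaka1970AdditiveGroups, additive forms and differential operators] -/
theorem notMem_vars_sub_sum_C_mul_X_pow (p : ℕ) [CharP K p] {P : MvPolynomial σ K} (hP : P.IsHomogeneous p) (S : Finset σ)
    (hD : ∀ i ∈ S, pderiv i P = 0) :
    ∀ i ∈ S, i ∉ (P - ∑ l ∈ S, C (coeff (Finsupp.single l p) P) * X l ^ p).vars := by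
  classical
  intro i hi hmem
  obtain ⟨d, hd, hdi⟩ := (mem_vars_iff_mem_support i).mp hmem
  have hdi' : d i ≠ 0 := Finsupp.mem_support_iff.mp hdi
  have hne := mem_support_iff.mp hd
  have hcs : coeff d (∑ l ∈ S, C (coeff (Finsupp.single l p) P) * X l ^ p) =
      ∑ l ∈ S, (if Finsupp.single l p = d then coeff (Finsupp.single l p) P else 0) := by
    rw [coeff_sum]
    exact Finset.sum_congr rfl fun l _ => by rw [C_mul_X_pow_eq_monomial, coeff_monomial]
  rw [coeff_sub, hcs] at hne
  by_cases h : ∃ l ∈ S, Finsupp.single l p = d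
  · obtain ⟨l₀, hl₀, hl₀d⟩ := h
    -- `p ≠ 0`: the monomial `d = X_{l₀}^p` has a non-zero exponent at `i`
    have hp : p ≠ 0 := by
      intro hp
      rw [← hl₀d, hp, Finsupp.single_zero] at hdi'
      exact hdi' rfl
    rw [Finset.sum_eq_single l₀, if_pos hl₀d, ← hl₀d, sub_self] at hne
    · exact hne rfl
    · intro l _ hll₀
      rw [if_neg]
      intro hld
      exact hll₀ ((Finsupp.single_left_inj hp).mp (hld.trans hl₀d.symm))
    · intro h'
      exact absurd hl₀ h'
  · simp only [not_exists, not_and] at h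
    rw [Finset.sum_eq_zero fun l hl => if_neg (h l hl), sub_zero] at hne
    exact h i hi (eq_single_of_pderiv_eq_zero p hP (hD i hi) (mem_support_iff.mpr hne) hdi').symm

/-- **THEOREM B″, first step, assembled.**  `F` homogeneous of degree `p`, free of the `T`-variables (the `W`-class); linear forms
`ℓ_i = Σ_{j ∈ T} c_{ij} X_j` with linearly independent coefficient rows; slots `f_i` (the `D`-moved `f`-class slots).  If
`Σ_i ℓ_i · ∂_{f_i} F = 0` (the `σ¹`-coefficient of the isotropy identity (★)), then `∂_{f_i} F = 0` for every `i`, and hence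
`F − Σ_i coeff_{X_{f_i}^p}(F) · X_{f_i}^p` involves none of the `X_{f_i}`: `F = Σ_i a_i f_i^p + F₀(f″)`. (derived here)
[cite: Hironaka1970AdditiveGroups, additive forms and differential operators] -/
theorem pderiv_eq_zero_and_normalForm (p : ℕ) [CharP K p] {ι : Type*} [Fintype ι] [DecidableEq σ] (T : Finset σ)
    (c : ι → σ → K) (hc : LinearIndependent K fun i => fun j : T => c i j) (f : ι → σ)
    {F : MvPolynomial σ K} (hF : F.IsHomogeneous p) (hT : ∀ l ∈ T, l ∉ F.vars)
    (h0 : ∑ i, (∑ j ∈ T, C (c i j) * X j) * pderiv (f i) F = 0) :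
    (∀ i, pderiv (f i) F = 0) ∧
      ∀ i, f i ∉ (F - ∑ l ∈ Finset.univ.image f, C (coeff (Finsupp.single l p) F) * X l ^ p).vars := by
  have hD : ∀ i, pderiv (f i) F = 0 :=
    eq_zero_of_sum_linearForm_mul_eq_zero' T c hc (fun i => pderiv (f i) F)
      (fun i l hl => notMem_vars_pderiv (f i) (hT l hl)) h0
  refine ⟨hD, fun i => ?_⟩
  refine notMem_vars_sub_sum_C_mul_X_pow p hF (Finset.univ.image f) ?_ (f i) (Finset.mem_image_of_mem f (Finset.mem_univ i))
  intro l hl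
  obtain ⟨i', -, rfl⟩ := Finset.mem_image.mp hl
  exact hD i'

end CharP

/-! ## §3 PROPOSITION B (3): the Frobenius pin in the coordinates of LEMMA K -/

section Boundary

variable {K : Type*} [Field K] {σ : Type*} [DecidableEq σ] [Fintype σ]

/-- **PROPOSITION B (3), monomial form.**  `P₁` homogeneous of degree `p = char K` (the pin form of the empty heavy part at the sharp
rate, `d₁ = p`), `r` a kernel direction (`Σ_k r_k ∂_k P₁ = 0`): after the class-linear change `A = lineSubst u₀ r` (column `u₀` of
`A` is `r`), every monomial of `P₁ ∘ A` containing the new coordinate `X_{u₀}` is `X_{u₀}^p`. (derived here)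
[cite: Hironaka1970AdditiveGroups, additive forms and differential operators] -/
theorem eq_single_of_lineSubst (p : ℕ) [CharP K p] (u₀ : σ) (r : σ → K) {P : MvPolynomial σ K} (hP : P.IsHomogeneous p)
    (hD : ∑ k, r k • pderiv k P = 0) {d : σ →₀ ℕ} (hd : d ∈ (lineSubst u₀ r P).support) (hdu : d u₀ ≠ 0) :
    d = Finsupp.single u₀ p :=
  eq_single_of_pderiv_eq_zero p (LinearRigidity.isHomogeneous_lineSubst u₀ r hP)
    (pderiv_lineSubst_eq_zero u₀ Finset.univ (fun k hk => absurd (Finset.mem_univ k) hk) hD) hd hdu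

/-- **PROPOSITION B (3): the Frobenius pin is present.**  If, in addition, the slot `u₀` stays pinned in the new coordinates
(`X_{u₀}` occurs in `P₁ ∘ A` — the model's `(P)`, `1/p > η`), then `X_{u₀}^p` is a monomial of `P₁ ∘ A` with non-zero coefficient:
"a slot of weight exactly `1/p` whose only pin is a Frobenius monomial `c · ε^p`, `c ≠ 0`". (derived here)
[cite: Hironaka1970AdditiveGroups, additive forms and differential operators] -/
theorem coeff_lineSubst_single_ne_zero (p : ℕ) [CharP K p] (u₀ : σ) (r : σ → K) {P : MvPolynomial σ K}
    (hP : P.IsHomogeneous p) (hD : ∑ k, r k • pderiv k P = 0) (hpin : u₀ ∈ (lineSubst u₀ r P).vars) :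
    coeff (Finsupp.single u₀ p) (lineSubst u₀ r P) ≠ 0 :=
  coeff_single_ne_zero_of_mem_vars p (LinearRigidity.isHomogeneous_lineSubst u₀ r hP)
    (pderiv_lineSubst_eq_zero u₀ Finset.univ (fun k hk => absurd (Finset.mem_univ k) hk) hD) hpin

/-- … and `P₁ ∘ A` minus that monomial is free of `X_{u₀}` ("its ONLY pin"). (derived here)
[cite: Hironaka1970AdditiveGroups, additive forms and differential operators] -/
theorem notMem_vars_lineSubst_sub (p : ℕ) [CharP K p] (u₀ : σ) (r : σ → K) {P : MvPolynomial σ K}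
    (hP : P.IsHomogeneous p) (hD : ∑ k, r k • pderiv k P = 0) :
    u₀ ∉ (lineSubst u₀ r P - C (coeff (Finsupp.single u₀ p) (lineSubst u₀ r P)) * X u₀ ^ p).vars :=
  notMem_vars_sub_C_mul_X_pow p (LinearRigidity.isHomogeneous_lineSubst u₀ r hP)
    (pderiv_lineSubst_eq_zero u₀ Finset.univ (fun k hk => absurd (Finset.mem_univ k) hk) hD)

end Boundary

end FrobeniusPin

end Literature.AlgebraicGeometry.Resolution.WeightedBlowup
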